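import Summits.BirchSwinnertonDyer.BirchSwinnertonDyer.Theorems.PrintCFramBottomClassIndexLawFiveLeGenusInternalIndexIdentity
import Summits.BirchSwinnertonDyer.BirchSwinnertonDyer.Theorems.PrintCFramBottomClassIndexLawFiveLeGenusInternalDisplay
import Summits.BirchSwinnertonDyer.BirchSwinnertonDyer.Theorems.PrintCFramBottomClassIndexLawFiveLeParitySplitPrimitivityFieldFactor
import Summits.BirchSwinnertonDyer.Rank1Residual.X12.O11.RouteUTwistCM
import Summits.BirchSwinnertonDyer.BirchSwinnertonDyer.Theorems.PrintCFramBottomClassIndexLawFiveLeLevelDictionaryStrictSelmer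
import Summits.BirchSwinnertonDyer.BirchSwinnertonDyer.Theorems.PrintCFramBottomClassIndexLawFiveLeKrizLiBindersCharacters
import Summits.BirchSwinnertonDyer.BirchSwinnertonDyer.Theorems.PrintCFramBottomClassIndexLawFiveLeKrizLiBinders
import Summits.BirchSwinnertonDyer.Rank1Residual.X12.O11.RouteUBernoulliD11
import Literature.NumberTheory.EllipticCurves.BSDQuadraticDescentShaOddPartGeneralProofs
import Literature.NumberTheory.EllipticCurves.BSDQuadraticDescentTorsionOddPartProofs
import Literature.NumberTheory.EllipticCurves.Rank1Residual.Typed.KolyvaginCertificate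
import HarnessLib

/-!
# Crux `PrintCFram.BottomClassIndexLawFiveLe` (stmt-BirchSwinnertonDyer-20372), line `eisenstein-resource-bdp-line`,
# branch «genus-internal Heegner fields» of `stub_seedOffExc`: THE Ш-INPUT OF THE IDENTITY ROAD AND ITS END STATE —
# `Ш(X₀(49))[7] = 0` with NO `L`-value, `ord₇ #Ш(X₀(49)/K) = 0`, and `BSD(W,7)` for the rank-one twist modulo `Ш(W)[7] = 0`

Width seat w3 g16 (prover-bsd-line-cfram-p1-w3-g16-0, 2026-08-29); helper `--supports stmt-BirchSwinnertonDyer-20372`;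
theorems only (0 defs / 0 named facts / 0 sorry). Third file of the IDENTITY road (p703060 `…GenusInternalDisplay`, p703748
`…GenusInternalIndexIdentity`; w6 g8's P1/P1b p702209/p703056). The road is an INDEPENDENT second proof of the branch's p = 7 end
(w7 g7's GI-2 halves road, p703735 `bsdp_twist_cm7_of_regular_kronecker`, is the first) with a DIFFERENT fact set — Kriz–Li Thm 1.20,
Gross–Zagier I.(6.3)/I.(7.3), Kolyvagin, GZK, modularity, Cassels–Tate, Burungale–Flach in rank 0 (`BSDp cm7 7`) and a level-49
parametrisation with `7 ∤ c` — and WITHOUT Hsieh 2014 Thm A / Liu–Zhang–Zhang 2018 Thm 1.5.1–1.5.3 / the toric bundle; it also runs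
at `u_K ≠ 2` (no `d_K < −4` anywhere).

* §1 **`sha_cm7_noSevenTorsion`** — `Ш(X₀(49)/ℚ)[7] = 0` granted Cassels–Tate and GZK, from `cm7.analyticRank = 0`, with NO `L`-VALUE:
  the cell's unit-class-factor Selmer bound `LevelDictionaryAlpha.natCard_selmerGroup_le_of_unit_classFactor` at the ODD datum
  `ψ = ω⁻¹` of `X₀(49)` (`X₀(49)[7]^{ss} = 𝔽₇(ω²) ⊕ 𝔽₇(ω⁵)`: the trace `ω² + ω⁵` is bsd-goldfeld's `hss_cm7_teichmuller_sq` with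
  `(ω²)⁻¹ω = ω⁻¹`; class factor `bernoulliOnePrim ψ⁻¹ = B_{1,ω}`, a `7`-unit by bsd-cm's `RouteU.norm_bernoulliOnePrim_teichmuller_seven`)
  ⟹ `#Sel₇(X₀(49)) ≤ 7`, then `ParitySplit.noPTorsion_of_natCard_selmerGroup_le_of_analyticRank_zero` (Cassels–Tate parity in rank 0).
* §2 `padicValNat_shaOrder_cm7_baseChange_eq_zero_of_noSevenTorsion` — for `K` quadratic and ANY model `W` of `X₀(49)^{(d_K)}`:
  `Ш(X₀(49))[7] = 0 ∧ Ш(W)[7] = 0 ∧ Ш(X₀(49)/K) finite ⟹ ord₇ #Ш(X₀(49)/K) = 0` (`Ш(E/K)[7^∞] ≅ Ш(E)[7^∞] ⊕ Ш(E^{d_K})[7^∞]`,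
  `card_primaryComponent_sha_baseChange_quadratic_of_odd_of_finite`, any parity of `d_K`).
* §3 **`bsdp_twist_cm7_of_regular_of_sha_twist`** — THE IDENTITY-ROAD END STATE modulo `Ш(W)[7] = 0`: for `K` imaginary quadratic
  with the Heegner hypothesis for `N = N_{X₀(49)} (= 49)`, `ε_K` Kronecker and a primitive `χ ⊥ 7` agreeing with `ε_K` off a finite set
  with `7 ∤ B_{5,χ}/5` (class regularity, w6 g8's spelling), a level-`N` datum `Dt` with `7 ∤ c(Dt)`, `H`, `ι`, `ιp`, the Heegner
  point `P`, and ANY globally minimal `W ≅ X₀(49)^{(d_K)}` with `ord_{s=1} L(W,s) = 1` and `Ш(W)[7] = 0`: granted Thm 1.20, GZ, Kolyvagin,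
  GZK, modularity, GZ I.(7.3), CT, `BSDp cm7 7`, `cm7.analyticRank = 0` — **`BSDp W 7`**. Chain: P1b `not_norm_nsCountLog_le_heegnerPoint_cm7_of_regular`
  (unit log from regularity) → `indexIdentityAt_cm7_seven_of_not_le_inv` (p703748) with the Ш-input of §1–§2 → `bsdp_twist_of_indexIdentityAt_of_bsdp_rankZero`
  (p703060). `…_kronecker`: `χ := ε_K`. The binder `Ш(W)[7] = 0` is the cell's regular-member theorem
  `noPTorsion_of_unit_classFactor_of_analyticRank_one` in class-datum currency (router's side, w2 g14 GI-R);
  `bsdp_twist_cm7_of_regular_of_unitClassFactorDatum` discharges it from an odd unit-class-factor datum `(f_W, ψ_W, ω_W)` of `W`.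

HONEST FRAMING: bookkeeping; nothing here proves BSD for any curve unconditionally, or any registered stub; `stub_seedOffExc` is untouched;
adoption/routing of the branch is the LEAD's call. No summit statement is proved by this seat.

References: [KrizLi2019] Thm. 1.20, Rem. 3.10, §10.3; [Cassels1962ArithmeticIV]; [GrossZagier1986] I.(6.3), I.(7.3), V.§2;
[Castella2018] (5.3); [BurungaleFlach2024] Cor. 2; [Washington1997] §5.1; [Mazur1978] Prop. 6.3.
-/

set_option autoImplicit false

-- `Summit.BirchSwinnertonDyer.BirchSwinnertonDyer.…`: the summit and its single sub-problem share a name.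
set_option linter.dupNamespace false

noncomputable section

open scoped Classical

open WeierstrassCurve NumberField DirichletCharacter
  Literature.NumberTheory.EllipticCurves
  Literature.NumberTheory.EllipticCurves.ModularForms
  Literature.NumberTheory.EllipticCurves.KrizLi2019
  Literature.NumberTheory.LFunctions
  Literature.NumberTheory.EllipticCurves.Rank1Residual
  Literature.NumberTheory.EllipticCurves.Rank1Residual.Typed
  Summit.BirchSwinnertonDyer.Rank1Residual
  Summit.BirchSwinnertonDyer.Rank1Residual.X12.O11
  Summit.BirchSwinnertonDyer.BirchSwinnertonDyer.Theorems.GoldfeldGoodTwists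
  Summit.BirchSwinnertonDyer.BirchSwinnertonDyer.Theorems.PrintCFram

namespace Summit.BirchSwinnertonDyer.BirchSwinnertonDyer.Theorems.PrintCFram.GenusInternal

/-! ## §1. `Ш(X₀(49)/ℚ)[7] = 0` from the unit class factor `B_{1,ω}` (no `L`-value) -/

/-- **`Ш(X₀(49)/ℚ)[7] = 0`, granted Cassels–Tate and GZK, from `ord_{s=1} L(X₀(49),s) = 0` — with NO `L`-value.** The odd datum of
`X₀(49) = cm7` at `7` is `ψ = ω⁻¹` (`= ω⁵`; `X₀(49)[7]^{ss} = 𝔽₇(ω²) ⊕ 𝔽₇(ω⁵)`): its trace form `ψ + ψ⁻¹ω = ω⁻¹ + ω²` is bsd-goldfeld's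
`hss_cm7_teichmuller_sq` (`ω² + (ω²)⁻¹ω`), and its class factor is `bernoulliOnePrim ψ⁻¹ = B_{1,ω}`, a `7`-adic unit (bsd-cm
`RouteU.norm_bernoulliOnePrim_teichmuller_seven`, `B_{1,ω} ≡ 3 (mod 7)`). The cell's unit-class-factor Selmer bound
`LevelDictionaryAlpha.natCard_selmerGroup_le_of_unit_classFactor` gives `#Sel^{(7)}(X₀(49)/ℚ) ≤ 7`, and in analytic rank `0` Cassels–Tate
parity forces `Ш[7] = 0` (`ParitySplit.noPTorsion_of_natCard_selmerGroup_le_of_analyticRank_zero`). CONDITIONAL on `hCT`, `hGZK`, `hr0`.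
[cite: Cassels1962ArithmeticIV] [cite: KrizLi2019, §2 (trace form) and Thm. 1.20] [cite: Washington1997, §5.1 and Thm. 4.2]
[cite: Mazur1978, Prop. 6.3 (1) (p. 153)] -/
theorem sha_cm7_noSevenTorsion (hCT : exists_casselsTate_pairing (K := ℚ))
    (hGZK : rank_eq_analyticRank_of_analyticRank_le_one) (hr0 : cm7.analyticRank = 0) :
    ∀ x : cm7.sha, ((7 : ℕ) : ℤ) • x = 0 → x = 0 := by
  obtain ⟨ω, hω⟩ := exists_isTeichmullerCharacter (p := 7)
  -- the odd datum `ψ = ω⁻¹`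
  have hω1 : ω (-1) = -1 := KrizLiBinders.teichmuller_apply_neg_one (p := 7) (by norm_num) hω
  have hψodd : (ω⁻¹).Odd := by
    change ω⁻¹ (-1 : ZMod 7) = -1
    rw [MulChar.inv_apply_eq_inv', hω1, inv_neg_one]
  -- its trace form is `hss_cm7_teichmuller_sq` reordered: `ω⁻¹ + (ω⁻¹)⁻¹·ω = ω² + (ω²)⁻¹·ω`
  have hss : ∀ ℓ : ℕ, ℓ.Prime → ¬ (ℓ ∣ 7 * cm7.conductorNorm ℤ) →
      ‖((cm7.LFunction ℓ : ℤ) : ℚ_[7]) - (ω⁻¹ (ℓ : ZMod 7) + (ω⁻¹)⁻¹ (ℓ : ZMod 7) * ω (ℓ : ZMod 7))‖ < 1 := by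
    intro ℓ hℓ hℓN
    have h := hss_cm7_teichmuller_sq ω hω ℓ hℓ hℓN
    have e1 : (ω ^ 2)⁻¹ (ℓ : ZMod 7) * ω (ℓ : ZMod 7) = ω⁻¹ (ℓ : ZMod 7) := by
      rw [← MulChar.mul_apply]
      congr 1
      rw [pow_two, mul_inv, mul_assoc, inv_mul_cancel, mul_one]
    have e2 : (ω⁻¹)⁻¹ (ℓ : ZMod 7) * ω (ℓ : ZMod 7) = (ω ^ 2) (ℓ : ZMod 7) := by
      rw [inv_inv, ← MulChar.mul_apply, ← pow_two]
    rw [e2, add_comm, ← e1]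
    exact h
  -- the class factor `B_{1,ω}` is a unit
  have hcls : ¬ ‖bernoulliOnePrim (ω⁻¹)⁻¹‖ ≤ ((7 : ℕ) : ℝ)⁻¹ := by
    rw [inv_inv, RouteU.norm_bernoulliOnePrim_teichmuller_seven ω hω]
    norm_num
  have hsel := LevelDictionaryAlpha.natCard_selmerGroup_le_of_unit_classFactor cm7 7 hasCM_cm7'
    KrizLiBinders.cmRamified_bases.1 (by norm_num) (ω⁻¹) ω hψodd hω hss hcls
  exact ParitySplit.noPTorsion_of_natCard_selmerGroup_le_of_analyticRank_zero cm7 7 hCT hGZK hr0 hsel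

/-! ## §2. `ord₇ #Ш(X₀(49)/K) = 0` from the two factors (any parity of `d_K`) -/

/-- **`ord₇ #Ш(X₀(49)/K) = 0`** for a quadratic field `K` and ANY model `W` of `X₀(49)^{(d_K)}`, from `Ш(X₀(49)/ℚ)[7] = 0`, `Ш(W/ℚ)[7] = 0`
and the finiteness of the three groups: `#Ш(E/K)[7^∞] = #Ш(E/ℚ)[7^∞] · #Ш(E^{(d_K)}/ℚ)[7^∞]` (the odd-`p` quadratic descent of `Ш`,
`card_primaryComponent_sha_baseChange_quadratic_of_odd_of_finite`, no parity hypothesis on `d_K`), each factor `= 7^{ord₇ #}`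
(`natCard_primaryComponent_eq_pow_padicValNat`) with exponent `0` (`padicValNat_shaOrder_eq_zero_of_noPTorsion`).
[cite: GrossZagier1986, V.§2 (pp. 310–312)] [cite: Cassels1965ArithmeticVIII] -/
theorem padicValNat_shaOrder_cm7_baseChange_eq_zero_of_noSevenTorsion
    (K : Type) [Field K] [NumberField K] (h2 : Module.finrank ℚ K = 2)
    (W : WeierstrassCurve ℚ) [W.IsElliptic]
    (hW : ∃ C : VariableChange ℚ, C • W = cm7.quadraticTwist (NumberField.discr K : ℚ))
    [Finite cm7.sha] [Finite W.sha] (hfinK : Finite (cm7.baseChange K).sha)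
    (h0 : ∀ x : cm7.sha, ((7 : ℕ) : ℤ) • x = 0 → x = 0) (h0W : ∀ x : W.sha, ((7 : ℕ) : ℤ) • x = 0 → x = 0) :
    padicValNat 7 (cm7.baseChange K).shaOrder = 0 := by
  haveI := hfinK
  haveI : (cm7.baseChange K).IsElliptic := isElliptic_baseChange' cm7 K
  obtain ⟨C, hC⟩ := hW
  have hCd : C⁻¹ • cm7.quadraticTwist (NumberField.discr K : ℚ) = W := by rw [← hC, inv_smul_smul]
  have hcard := card_primaryComponent_sha_baseChange_quadratic_of_odd_of_finite cm7 K h2 W ⟨C⁻¹, hCd⟩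
    (cm7.baseChange K) ⟨1, one_smul _ _⟩ 7 (by norm_num)
  have hsha : padicValNat 7 (cm7.baseChange K).shaOrder =
      padicValNat 7 cm7.shaOrder + padicValNat 7 W.shaOrder := by
    rw [WeierstrassCurve.shaOrder, WeierstrassCurve.shaOrder, WeierstrassCurve.shaOrder,
      ← (Nat.pow_right_injective (by norm_num : 2 ≤ 7)).eq_iff, pow_add,
      ← natCard_primaryComponent_eq_pow_padicValNat 7, ← natCard_primaryComponent_eq_pow_padicValNat 7,
      ← natCard_primaryComponent_eq_pow_padicValNat 7]
    exact hcard
  rw [hsha, padicValNat_shaOrder_eq_zero_of_noPTorsion cm7 7 ‹Finite cm7.sha› h0,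
    padicValNat_shaOrder_eq_zero_of_noPTorsion W 7 ‹Finite W.sha› h0W]

/-! ## §3. THE IDENTITY-ROAD END STATE at `(X₀(49), 7)` modulo `Ш(W)[7] = 0` -/

/-- **`BSD(W,7)` for the rank-one twist `W ≅ X₀(49)^{(d_K)}` of a `7`-REGULAR Heegner field, by the IDENTITY road, modulo
`Ш(W)[7] = 0`.** Data: `K` imaginary quadratic with the Heegner hypothesis for `N = N_{X₀(49)}` (`= 49`: `7` splits), its Kronecker
character `ε_K` and a primitive `χ` mod `m ⊥ 7` agreeing with `ε_K` at all primes `ℓ ∤ N₀` with `7 ∤ B_{5,χ}/5` (class regularity); a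
level-`N` parametrisation datum `Dt` with `7 ∤ c(Dt)`, a Heegner datum `H`, `ι : K → ℂ`, `ιp : K → ℚ₇`, the Heegner point `P`; ANY globally
minimal `W` with `C • W = X₀(49)^{(d_K)}`, `ord_{s=1} L(W,s) = 1` and `Ш(W/ℚ)[7] = 0`. Facts by name: Kriz–Li Thm 1.20 (`h120`),
Gross–Zagier/Kolyvagin at `(N, cm7, K)`, GZK, modularity, Gross–Zagier I.(7.3), Cassels–Tate, and the rank-zero inputs `BSDp cm7 7`
(Burungale–Flach Cor. 2) and `cm7.analyticRank = 0`. Conclusion: **`BSDp W 7`**. Chain: unit `7`-adic logarithm of `P` from regularity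
(w6 g8 P1b `not_norm_nsCountLog_le_heegnerPoint_cm7_of_regular`) → `X11b.IndexIdentityAt cm7 7 K P` (`indexIdentityAt_cm7_seven_of_not_le_inv`,
with the Ш-input of §1–§2: `Ш(X₀(49))[7] = 0` by §1, `Ш(W)[7] = 0` by hypothesis, finiteness over `K` supplied by the display's Kolyvagin
step) → the parity-free, `d_K`-free display and twist-up brick `bsdp_twist_of_indexIdentityAt_of_bsdp_rankZero`. No Hsieh / Liu–Zhang–Zhang /
toric input; valid for every `d_K` (u_K ≠ 2 included). CONDITIONAL on the named facts and on `h0W`. [cite: KrizLi2019, Thm. 1.20 (pp. 7–8), §10.3]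
[cite: CastellaEtAl2021, Thm. 5.3.1 and (5.5)–(5.7)] [cite: BurungaleFlach2024, Cor. 2] [cite: Cassels1962ArithmeticIV] [cite: Miller2011LMS, Def. 1.1] -/
theorem bsdp_twist_cm7_of_regular_of_sha_twist (h120 : thm120_padicLogHeegner_unit_of_bernoulli)
    (hCT : exists_casselsTate_pairing (K := ℚ)) (hGZK : rank_eq_analyticRank_of_analyticRank_le_one)
    (hmod : hasEntireLFunction_rat) (hGZ73 : GrossZagier1986_thm_I_7_3)
    (hB : BSDp cm7 7) (hr0 : cm7.analyticRank = 0)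
    {N : ℕ} [NeZero N] (hN : cm7.conductorNorm ℤ = N)
    (K : Type) [Field K] [NumberField K] (hK : IsImaginaryQuadratic K) (hH : SatisfiesHeegnerHypothesis N K)
    (hGZ : gross_zagier N cm7 K) (hKo : kolyvagin N cm7 K)
    (εK : DirichletCharacter ℚ_[7] (NumberField.discr K).natAbs) (hεK : IsKroneckerCharacterOf K εK)
    {m : ℕ} [NeZero m] (χ : DirichletCharacter ℚ_[7] m) (hχ : χ.IsPrimitive) (hm7 : m.Coprime 7)
    {N₀ : ℕ} (hN₀ : N₀ ≠ 0)
    (hχε : ∀ ℓ : ℕ, ℓ.Prime → ¬ ℓ ∣ N₀ → χ (ℓ : ZMod m) = εK (ℓ : ZMod (NumberField.discr K).natAbs))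
    (hreg : ¬ ‖(5 : ℚ_[7])⁻¹ * generalizedBernoulli 5 χ‖ ≤ (7 : ℝ)⁻¹)
    (Dt : ModularParametrizationData cm7 N) (H : HeegnerDatum N (NumberField.discr K)) (ι : K →+* ℂ) (ιp : K →+* ℚ_[7])
    (P : (cm7.baseChange K).toAffine.Point)
    (hP : WeierstrassCurve.Affine.Point.map ι.toRatAlgHom P = heegnerPointComplex Dt H)
    (hc : ¬ (7 : ℤ) ∣ Dt.c)
    (W : WeierstrassCurve ℚ) [W.IsElliptic] [W.IsGloballyMinimal]
    (hW : ∃ C : VariableChange ℚ, C • W = cm7.quadraticTwist (NumberField.discr K : ℚ)) (hrW : W.analyticRank = 1)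
    (h0W : ∀ x : W.sha, ((7 : ℕ) : ℤ) • x = 0 → x = 0) : BSDp W 7 := by
  subst hN
  have h7N : 7 ∣ cm7.conductorNorm ℤ := by rw [conductorNorm_cm7]; norm_num
  have hH7 : SatisfiesHeegnerHypothesis 7 K := hH.of_dvd h7N
  -- the unit logarithm from class regularity (Kriz–Li Thm 1.20 at `(X₀(49), 7, ω²)`, w6 g8 P1/P1b)
  have hunit := not_norm_nsCountLog_le_heegnerPoint_cm7_of_regular h120 K hK hH εK hεK χ hχ hm7 hN₀ hχε hreg
    Dt H ι ιp P hP
  -- finiteness of `Ш(X₀(49))` and `Ш(W)` over `ℚ` (GZK in analytic rank ≤ 1)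
  obtain ⟨-, hfin0⟩ := hGZK cm7 (by rw [hr0]; exact zero_le_one)
  obtain ⟨-, hfinW⟩ := hGZK W hrW.le
  haveI : Finite cm7.sha := hfin0
  haveI : Finite W.sha := hfinW
  -- the `hid` socket: the index identity over `K` from the unit log and the Ш-input
  have hid : Finite (cm7.baseChange K).sha → X11b.IndexIdentityAt cm7 7 K P := fun hfinK =>
    indexIdentityAt_cm7_seven_of_not_le_inv ιp P (c := Dt.maninConstant) (by exact_mod_cast hc)
      (by exact_mod_cast hunit)
      (padicValNat_shaOrder_cm7_baseChange_eq_zero_of_noSevenTorsion K hK.1 W hW hfinK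
        (sha_cm7_noSevenTorsion hCT hGZK hr0) h0W)
  exact bsdp_twist_of_indexIdentityAt_of_bsdp_rankZero cm7 7 (cm7.conductorNorm ℤ) K Dt H ι P hGZ hKo hGZK hmod hGZ73
    hK rfl hH hH7 hP (by norm_num) hc hr0 hB W hW hrW hid

/-- **The same with `χ := ε_K`** (regularity read on the Kronecker character itself: `7 ∤ B_{5,ε_K}/5`; `7 ∤ d_K` because `7 ∣ N`
splits in `K`). [cite: KrizLi2019, Thm. 1.20 (pp. 7–8)] [cite: BurungaleFlach2024, Cor. 2] [cite: Miller2011LMS, Def. 1.1] -/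
theorem bsdp_twist_cm7_of_regular_kronecker_of_sha_twist (h120 : thm120_padicLogHeegner_unit_of_bernoulli)
    (hCT : exists_casselsTate_pairing (K := ℚ)) (hGZK : rank_eq_analyticRank_of_analyticRank_le_one)
    (hmod : hasEntireLFunction_rat) (hGZ73 : GrossZagier1986_thm_I_7_3)
    (hB : BSDp cm7 7) (hr0 : cm7.analyticRank = 0)
    {N : ℕ} [NeZero N] (hN : cm7.conductorNorm ℤ = N)
    (K : Type) [Field K] [NumberField K] (hK : IsImaginaryQuadratic K) (hH : SatisfiesHeegnerHypothesis N K)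
    (hGZ : gross_zagier N cm7 K) (hKo : kolyvagin N cm7 K)
    (εK : DirichletCharacter ℚ_[7] (NumberField.discr K).natAbs) (hεK : IsKroneckerCharacterOf K εK)
    (hreg : ¬ ‖(5 : ℚ_[7])⁻¹ * generalizedBernoulli 5 εK‖ ≤ (7 : ℝ)⁻¹)
    (Dt : ModularParametrizationData cm7 N) (H : HeegnerDatum N (NumberField.discr K)) (ι : K →+* ℂ) (ιp : K →+* ℚ_[7])
    (P : (cm7.baseChange K).toAffine.Point)
    (hP : WeierstrassCurve.Affine.Point.map ι.toRatAlgHom P = heegnerPointComplex Dt H)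
    (hc : ¬ (7 : ℤ) ∣ Dt.c)
    (W : WeierstrassCurve ℚ) [W.IsElliptic] [W.IsGloballyMinimal]
    (hW : ∃ C : VariableChange ℚ, C • W = cm7.quadraticTwist (NumberField.discr K : ℚ)) (hrW : W.analyticRank = 1)
    (h0W : ∀ x : W.sha, ((7 : ℕ) : ℤ) • x = 0 → x = 0) : BSDp W 7 := by
  haveI : NeZero (NumberField.discr K).natAbs := ⟨Int.natAbs_ne_zero.mpr (NumberField.discr_ne_zero K)⟩
  have h7N : (7 : ℕ) ∣ N := by rw [← hN, conductorNorm_cm7]; norm_num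
  have h7d : ¬ 7 ∣ (NumberField.discr K).natAbs := by
    rw [← Int.natCast_dvd]
    exact Literature.SatisfiesHeegnerHypothesis.not_dvd_discr hK.1 hH (by norm_num) h7N
  have hd7 : (NumberField.discr K).natAbs.Coprime 7 :=
    ((Nat.Prime.coprime_iff_not_dvd (by norm_num)).mpr h7d).symm
  exact bsdp_twist_cm7_of_regular_of_sha_twist h120 hCT hGZK hmod hGZ73 hB hr0 hN K hK hH hGZ hKo εK hεK εK hεK.1 hd7
    one_ne_zero (fun _ _ _ => rfl) hreg Dt H ι ιp P hP hc W hW hrW h0W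

/-- **The END STATE with `Ш(W)[7] = 0` DISCHARGED from an odd unit-class-factor datum of `W`** (the cell's regular-member
Selmer count `ParitySplit.noPTorsion_of_unit_classFactor_of_analyticRank_one`, mod Cassels–Tate + GZK): replace the binder `h0W` of
`bsdp_twist_cm7_of_regular_of_sha_twist` by an odd `ℚ₇`-valued datum `(f_W, ψ_W, ω_W)` for `W` — trace form `hssW` and UNIT class factor
`¬ ‖bernoulliOnePrim ψ_W⁻¹‖ ≤ 7⁻¹` (for `W ≅ X₀(49)^{(d_K)}`: `ψ_W = ω²·ε_K`, whose class factor `B_{1,ω⁴ε_K} ≡ B_{5,ε_K}/5` is the same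
regularity number `hreg`, cf. w6 g8's `norm_bernoulliOnePrim_bernoulliCharOne_le_inv_iff`). CM and CM-ramification of `W` from
bsd-cm's `RouteU.hasCM_of_twist_cm7` / `cmFieldDiscrOfJ_of_twist_cm7`. [cite: KrizLi2019, Thm. 1.20 and §2] [cite: Cassels1962ArithmeticIV]
[cite: BurungaleFlach2024, Cor. 2] [cite: Miller2011LMS, Def. 1.1] -/
theorem bsdp_twist_cm7_of_regular_of_unitClassFactorDatum (h120 : thm120_padicLogHeegner_unit_of_bernoulli)
    (hCT : exists_casselsTate_pairing (K := ℚ)) (hGZK : rank_eq_analyticRank_of_analyticRank_le_one)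
    (hmod : hasEntireLFunction_rat) (hGZ73 : GrossZagier1986_thm_I_7_3)
    (hB : BSDp cm7 7) (hr0 : cm7.analyticRank = 0)
    {N : ℕ} [NeZero N] (hN : cm7.conductorNorm ℤ = N)
    (K : Type) [Field K] [NumberField K] (hK : IsImaginaryQuadratic K) (hH : SatisfiesHeegnerHypothesis N K)
    (hGZ : gross_zagier N cm7 K) (hKo : kolyvagin N cm7 K)
    (εK : DirichletCharacter ℚ_[7] (NumberField.discr K).natAbs) (hεK : IsKroneckerCharacterOf K εK)
    {m : ℕ} [NeZero m] (χ : DirichletCharacter ℚ_[7] m) (hχ : χ.IsPrimitive) (hm7 : m.Coprime 7)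
    {N₀ : ℕ} (hN₀ : N₀ ≠ 0)
    (hχε : ∀ ℓ : ℕ, ℓ.Prime → ¬ ℓ ∣ N₀ → χ (ℓ : ZMod m) = εK (ℓ : ZMod (NumberField.discr K).natAbs))
    (hreg : ¬ ‖(5 : ℚ_[7])⁻¹ * generalizedBernoulli 5 χ‖ ≤ (7 : ℝ)⁻¹)
    (Dt : ModularParametrizationData cm7 N) (H : HeegnerDatum N (NumberField.discr K)) (ι : K →+* ℂ) (ιp : K →+* ℚ_[7])
    (P : (cm7.baseChange K).toAffine.Point)
    (hP : WeierstrassCurve.Affine.Point.map ι.toRatAlgHom P = heegnerPointComplex Dt H)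
    (hc : ¬ (7 : ℤ) ∣ Dt.c)
    (W : WeierstrassCurve ℚ) [W.IsElliptic] [W.IsGloballyMinimal]
    (hW : ∃ C : VariableChange ℚ, C • W = cm7.quadraticTwist (NumberField.discr K : ℚ)) (hrW : W.analyticRank = 1)
    -- an odd unit-class-factor datum for `W`
    {fW : ℕ} [NeZero fW] (ψW : DirichletCharacter ℚ_[7] fW) (ωW : DirichletCharacter ℚ_[7] 7)
    (hψW : ψW.Odd) (hωW : IsTeichmullerCharacter ωW)
    (hssW : ∀ ℓ : ℕ, ℓ.Prime → ¬ (ℓ ∣ 7 * W.conductorNorm ℤ) →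
      ‖((W.LFunction ℓ : ℤ) : ℚ_[7]) - (ψW (ℓ : ZMod fW) + ψW⁻¹ (ℓ : ZMod fW) * ωW (ℓ : ZMod 7))‖ < 1)
    (hclsW : ¬ ‖bernoulliOnePrim ψW⁻¹‖ ≤ ((7 : ℕ) : ℝ)⁻¹) : BSDp W 7 := by
  have hd0 : (NumberField.discr K : ℤ) ≠ 0 := NumberField.discr_ne_zero K
  have hCM : W.HasCM := RouteU.hasCM_of_twist_cm7 W hd0 hW
  have hram : CMRamified W 7 := by
    rw [CMRamified, RouteU.cmFieldDiscrOfJ_of_twist_cm7 W hd0 hW]; norm_num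
  have h0W : ∀ x : W.sha, ((7 : ℕ) : ℤ) • x = 0 → x = 0 :=
    ParitySplit.noPTorsion_of_unit_classFactor_of_analyticRank_one hCT hGZK W hCM hram (by norm_num) hrW ψW ωW hψW hωW
      hssW hclsW
  exact bsdp_twist_cm7_of_regular_of_sha_twist h120 hCT hGZK hmod hGZ73 hB hr0 hN K hK hH hGZ hKo εK hεK χ hχ hm7 hN₀ hχε
    hreg Dt H ι ιp P hP hc W hW hrW h0W

end Summit.BirchSwinnertonDyer.BirchSwinnertonDyer.Theorems.PrintCFram.GenusInternal

end
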